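import Literature.Analysis.FluidPDE.PlanarVorticityMoments
import Literature.Analysis.FluidPDE.PlanarVorticityMaxPrinciple
import HarnessLib

/-!
# A uniform-in-time sup bound for the velocity of a planar viscous flow with non-negative vorticity:
# `‖v(·, t)‖_∞ ≤ A R + Ω₂/(2πR)` (Majda–Bertozzi (8.27) with Prop. 1.14 (i) and §3.3)

Literature file (topic `Analysis/FluidPDE`), theorems only. Sources: A. J. Majda, A. L. Bertozzi,
*Vorticity and Incompressible Flow* (CUP 2002): §8.2.3, Prop. 8.2 (i), eq. (8.27) (held text
p. 275) — "`‖v(·,t)‖_{L^∞} ≤ ‖ρK‖_{L¹}‖ω‖_{L^∞} + ‖(1 − ρ)K‖_{L^∞}‖ω‖_{L¹} ≤ c|||ω(·,t)|||`", in the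
tree with the sharp cutoff at an arbitrary radius `R` as `norm_biotSavart2D_le_of_radius`
(`‖K₂ ∗ ω(x)‖ ≤ A R + (2πR)⁻¹‖ω‖_{L¹}` for `|ω| ≤ A`); §3.3 before Cor. 3.3 (held text p. 105) —
the maximum principle `|ω(·, t)|_{L^∞} ≤ |ω₀|_{L^∞}` (tree: `PlanarVorticityMaxPrinciple`); §1.7
Prop. 1.14 (i) (held text p. 31) — conservation of the vorticity flux `Ω₂ = ∫ω` (tree:
`PlanarVorticityMoments`).

## What is typed

For a classical planar Navier–Stokes solution `(u, p)` on a convex time set `S` (`ν ≥ 0`, curl-free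
force) whose vorticity has uniform rapid decay on `S` and whose velocity is the Biot–Savart velocity
of its vorticity, with NON-NEGATIVE vorticity `0 ≤ ω(t₀, ·) ≤ A` at some `t₀ ∈ S`: at every later
time `t ∈ S` the vorticity stays in `[0, A]` (minimum / maximum principle on `[t₀, t] ⊆ S`), its `L¹`
norm is the conserved flux `Ω₂ = ∫ω(t₀)`, and hence

* `IsClassicalNSSolutionOn.norm_le_of_planarVorticity_nonneg` — for every `t ≥ t₀` in `S`, `R > 0`,
  `x`: `‖u(t, x)‖ ≤ A R + (2πR)⁻¹ Ω₂`;
* `IsClassicalNSSolutionOn.norm_le_two_mul_sqrt_of_planarVorticity_nonneg` — the optimised radius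
  `R = (Ω₂/2πA)^{1/2}`: `‖u(t, x)‖ ≤ 2 (A Ω₂/2π)^{1/2}` uniformly in `t ≥ t₀` (`A > 0`).

HONEST FRAMING (cell `ns-blowup`, bears_on LADDER-NS N1 crux `HeredityFromTwo`): a classical planar
a-priori bound; in the cell it is read through Lundgren's transformation (the swirl speed of a
stretched tube grows at most like `S^{1/2}`); nothing here concerns three-dimensional regularity.

## References

* [MajdaBertozziCUP2002] A. J. Majda, A. L. Bertozzi, CUP 2002 — §8.2.3 Prop. 8.2 (i) (8.27)
  (held text p. 275); §3.3 before Cor. 3.3 (p. 105); §1.7 Prop. 1.14 (i) (p. 31).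
-/

noncomputable section

open Set Function Filter MeasureTheory Metric InnerProductSpace
open scoped ContDiff RealInnerProductSpace Topology

namespace Literature.Analysis.FluidPDE

section Planar

variable {S : Set ℝ} {ν : ℝ} {f u : ℝ → EuclideanSpace ℝ (Fin 2) → EuclideanSpace ℝ (Fin 2)}
  {p : ℝ → EuclideanSpace ℝ (Fin 2) → ℝ}

/-- The scalar vorticity of a `C¹` planar field is continuous. [folklore] -/
private theorem continuous_planarVorticity {v : EuclideanSpace ℝ (Fin 2) → EuclideanSpace ℝ (Fin 2)}
    (hv : ContDiff ℝ 1 v) : Continuous (PlanarEigenmode.vorticity v) := by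
  have hc : ∀ e : EuclideanSpace ℝ (Fin 2), Continuous fun x => fderiv ℝ v x e := fun e =>
    (hv.continuous_fderiv one_ne_zero).clm_apply continuous_const
  have hcomp : ∀ (e : EuclideanSpace ℝ (Fin 2)) (i : Fin 2), Continuous fun x => fderiv ℝ v x e i :=
    fun e i => (PiLp.continuous_apply _ _ i).comp (hc e)
  unfold PlanarEigenmode.vorticity
  exact (hcomp _ 1).sub (hcomp _ 0)

/-- Uniform rapid decay gives decay of `|ω|` near spatial infinity, uniformly in time:
`|ω(t, x)| ≤ C(1 + ‖x‖)⁻¹ ≤ δ` for `‖x‖ ≥ C/δ`. [folklore] -/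
private theorem decay_of_hasUniformRapidDecayOn' {S : Set ℝ}
    {w : ℝ → EuclideanSpace ℝ (Fin 2) → ℝ} (hw : HasUniformRapidDecayOn S w) (δ : ℝ) (hδ : 0 < δ) :
    ∃ R : ℝ, ∀ t ∈ S, ∀ x : EuclideanSpace ℝ (Fin 2), R ≤ ‖x‖ → |w t x| ≤ δ := by
  obtain ⟨C, hC0, hC⟩ := hw.norm_le_rpow 1
  refine ⟨C / δ, fun t ht x hx => ?_⟩
  have h1 := hC t ht x
  rw [Real.norm_eq_abs, Nat.cast_one, Real.rpow_neg_one] at h1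
  have hx0 : 0 < 1 + ‖x‖ := by positivity
  calc |w t x| ≤ C * (1 + ‖x‖)⁻¹ := h1
    _ ≤ δ := by
        rw [← div_eq_mul_inv, div_le_iff₀ hx0]
        have : C ≤ δ * ‖x‖ := by rwa [div_le_iff₀' hδ] at hx
        nlinarith

/-- A uniformly rapidly decaying planar vorticity is integrable at each time. [folklore] -/
private theorem integrable_of_hasUniformRapidDecayOn' {S : Set ℝ}
    {w : ℝ → EuclideanSpace ℝ (Fin 2) → ℝ} (hw : HasUniformRapidDecayOn S w) {t : ℝ} (ht : t ∈ S)
    (hc : Continuous (w t)) : Integrable (w t) (volume : Measure (EuclideanSpace ℝ (Fin 2))) := by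
  obtain ⟨C, hC0, hC⟩ := hw.norm_le_rpow 3
  refine integrable_of_norm_le_rpow_neg hc (C := C) (r := ((3 : ℕ) : ℝ)) ?_ fun x => hC t ht x
  rw [finrank_euclideanSpace_fin]; norm_num

/-- **Uniform-in-time sup bound for the velocity of a planar viscous flow with non-negative
vorticity** (MB (8.27) with the maximum principle and the conservation of the vorticity flux). Let
`(u, p)` be a classical planar Navier–Stokes solution on a convex time set `S` with `ν ≥ 0` and
curl-free force, whose vorticity `ω` has uniform rapid decay on `S` and whose velocity is the
Biot–Savart velocity of its vorticity, and let `0 ≤ ω(t₀, ·) ≤ A` at `t₀ ∈ S`. Then for every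
`t ≥ t₀` in `S`, every radius `R > 0` and every `x`: `‖u(t, x)‖ ≤ A R + (2πR)⁻¹ Ω₂`,
`Ω₂ = ∫ ω(t₀)` — since
`0 ≤ ω(t, ·) ≤ A` (`planarVorticity_ge_of_ge` / `_le_of_le`), `‖ω(t)‖_{L¹} = ∫ω(t) = Ω₂`
(`planarVorticity_moments_eq`), and `‖K₂ ∗ ω(t)‖_∞ ≤ A R + (2πR)⁻¹‖ω(t)‖_{L¹}`
(`norm_biotSavart2D_le_of_radius`).
[cite: MajdaBertozziCUP2002, §8.2.3 Prop. 8.2 (i) eq. (8.27) (held text p. 275); §3.3 before Cor. 3.3; §1.7 Prop. 1.14 (i)] -/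
theorem IsClassicalNSSolutionOn.norm_le_of_planarVorticity_nonneg
    (h : IsClassicalNSSolutionOn S ν f u p) (hS : Convex ℝ S) (hν : 0 ≤ ν)
    (hcurl : ∀ t ∈ S, ∀ x, PlanarEigenmode.vorticity (f t) x = 0)
    (hω : HasUniformRapidDecayOn S (fun t x => PlanarEigenmode.vorticity (u t) x))
    (hBS : ∀ t ∈ S, ∀ x, u t x = biotSavart2D (PlanarEigenmode.vorticity (u t)) x) {t₀ : ℝ}
    (ht₀ : t₀ ∈ S) (h0 : ∀ x, 0 ≤ PlanarEigenmode.vorticity (u t₀) x) {A : ℝ}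
    (hA : ∀ x, PlanarEigenmode.vorticity (u t₀) x ≤ A) {t : ℝ} (ht : t ∈ S) (htt : t₀ ≤ t) {R : ℝ}
    (hR : 0 < R) (x : EuclideanSpace ℝ (Fin 2)) :
    ‖u t x‖ ≤ A * R + (2 * Real.pi * R)⁻¹ * ∫ y, PlanarEigenmode.vorticity (u t₀) y := by
  -- the vorticity stays in `[0, A]` (minimum / maximum principle on the slab `[t₀, t] ⊆ S`)
  have hlohi : ∀ y, 0 ≤ PlanarEigenmode.vorticity (u t) y ∧ PlanarEigenmode.vorticity (u t) y ≤ A := by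
    rcases eq_or_lt_of_le htt with he | hlt
    · subst he; exact fun y => ⟨h0 y, hA y⟩
    have hsub : Icc t₀ t ⊆ S := hS.ordConnected.out ht₀ ht
    have h' : IsClassicalNSSolutionOn (Icc t₀ t) ν f u p := h.mono hsub (uniqueDiffOn_Icc hlt)
    have hdec : ∀ δ : ℝ, 0 < δ → ∃ R : ℝ, ∀ s ∈ Icc t₀ t, ∀ y : EuclideanSpace ℝ (Fin 2),
        R ≤ ‖y‖ → |PlanarEigenmode.vorticity (u s) y| ≤ δ := fun δ hδ => by
      obtain ⟨R, hR⟩ := decay_of_hasUniformRapidDecayOn' hω δ hδ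
      exact ⟨R, fun s hs y hy => hR s (hsub hs) y hy⟩
    have htI : t ∈ Icc t₀ t := right_mem_Icc.2 htt
    exact fun y =>
      ⟨h'.planarVorticity_ge_of_ge hν (fun s hs z => (hcurl s (hsub hs) z).symm.le) hdec h0 htI y,
        h'.planarVorticity_le_of_le hν (fun s hs z => (hcurl s (hsub hs) z).le) hdec hA htI y⟩
  have hlo : ∀ y, 0 ≤ PlanarEigenmode.vorticity (u t) y := fun y => (hlohi y).1
  have hhi : ∀ y, PlanarEigenmode.vorticity (u t) y ≤ A := fun y => (hlohi y).2
  have habs : ∀ y, |PlanarEigenmode.vorticity (u t) y| ≤ A := fun y => by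
    rw [abs_of_nonneg (hlo y)]; exact hhi y
  -- integrability and the `L¹` norm
  have hωc : Continuous (PlanarEigenmode.vorticity (u t)) :=
    continuous_planarVorticity (contDiff_infty.1 (h.contDiff_velocity ht) 1)
  have hωi : Integrable (PlanarEigenmode.vorticity (u t)) := integrable_of_hasUniformRapidDecayOn' hω ht hωc
  have hL1 : ∫ y, |PlanarEigenmode.vorticity (u t) y| = ∫ y, PlanarEigenmode.vorticity (u t₀) y := by
    rw [integral_congr_ae (Eventually.of_forall fun y => abs_of_nonneg (hlo y))]
    exact (h.planarVorticity_moments_eq hS hω hBS hcurl ht₀ ht 0).1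
  -- MB (8.27)
  rw [hBS t ht x, ← hL1]
  exact norm_biotSavart2D_le_of_radius hωi habs hR x

/-- **The optimised bound**: with `A > 0` and the radius `R = (Ω₂/2πA)^{1/2}` (or `R → 0` when
`Ω₂ = 0`), `‖u(t, x)‖ ≤ 2 (A Ω₂/2π)^{1/2}` for all `t ≥ t₀` in `S`, `x ∈ ℝ²` — a bound by the
initial peak vorticity and the circulation only, uniform in time.
[cite: MajdaBertozziCUP2002, §8.2.3 Prop. 8.2 (i) eq. (8.27) (held text p. 275); §3.3 before Cor. 3.3; §1.7 Prop. 1.14 (i)] -/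
theorem IsClassicalNSSolutionOn.norm_le_two_mul_sqrt_of_planarVorticity_nonneg
    (h : IsClassicalNSSolutionOn S ν f u p) (hS : Convex ℝ S) (hν : 0 ≤ ν)
    (hcurl : ∀ t ∈ S, ∀ x, PlanarEigenmode.vorticity (f t) x = 0)
    (hω : HasUniformRapidDecayOn S (fun t x => PlanarEigenmode.vorticity (u t) x))
    (hBS : ∀ t ∈ S, ∀ x, u t x = biotSavart2D (PlanarEigenmode.vorticity (u t)) x) {t₀ : ℝ}
    (ht₀ : t₀ ∈ S) (h0 : ∀ x, 0 ≤ PlanarEigenmode.vorticity (u t₀) x) {A : ℝ} (hA0 : 0 < A)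
    (hA : ∀ x, PlanarEigenmode.vorticity (u t₀) x ≤ A) {t : ℝ} (ht : t ∈ S) (htt : t₀ ≤ t)
    (x : EuclideanSpace ℝ (Fin 2)) :
    ‖u t x‖ ≤ 2 * Real.sqrt (A * (∫ y, PlanarEigenmode.vorticity (u t₀) y) / (2 * Real.pi)) := by
  set Γ : ℝ := ∫ y, PlanarEigenmode.vorticity (u t₀) y with hΓ
  have hΓ0 : 0 ≤ Γ := integral_nonneg h0
  have hπ : 0 < 2 * Real.pi := by positivity
  have hb := fun {R : ℝ} (hR : 0 < R) =>
    h.norm_le_of_planarVorticity_nonneg hS hν hcurl hω hBS ht₀ h0 hA ht htt hR x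
  rcases hΓ0.eq_or_lt with hz | hpos
  · -- `Ω₂ = 0`: let `R → 0`
    rw [← hz, mul_zero, zero_div, Real.sqrt_zero, mul_zero]
    refine le_of_forall_pos_le_add fun ε hε => ?_
    have h1 := hb (R := ε / A) (div_pos hε hA0)
    rw [← hΓ, ← hz, mul_zero, add_zero, mul_div_cancel₀ _ hA0.ne'] at h1
    linarith
  · -- `Ω₂ > 0`: the radius `σ/A`, `σ = (AΩ₂/2π)^{1/2}`
    set σ : ℝ := Real.sqrt (A * Γ / (2 * Real.pi)) with hσ
    have hσpos : 0 < σ := Real.sqrt_pos.2 (div_pos (mul_pos hA0 hpos) hπ)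
    have hσsq : σ ^ 2 = A * Γ / (2 * Real.pi) := Real.sq_sqrt (div_pos (mul_pos hA0 hpos) hπ).le
    have hσsq' : 2 * Real.pi * σ ^ 2 = A * Γ := by
      rw [hσsq]; field_simp
    have h1 := hb (R := σ / A) (div_pos hσpos hA0)
    rw [← hΓ] at h1
    have e1 : A * (σ / A) = σ := mul_div_cancel₀ _ hA0.ne'
    have e2 : (2 * Real.pi * (σ / A))⁻¹ * Γ = σ := by
      have hne : 2 * Real.pi * (σ / A) ≠ 0 := by positivity
      rw [inv_mul_eq_iff_eq_mul₀ hne]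
      field_simp
      linear_combination (-1 : ℝ) * hσsq'
    rw [e1, e2] at h1
    linarith

end Planar

end Literature.Analysis.FluidPDE

end
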